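import Summits.ValiantsHypothesis.ValiantsHypothesis.Theorems.BarrierLeverAnchoredDoorHitsLowerPairsDecrementGeneral

/-!
# Support item `AnchoredDoorHitsLowerPairs` (stmt-ValiantsHypothesis-22510), line `anchored-peeling`:
# RELABELLING INVARIANCE of the symbolic anchored minor, and CONJECTURE DC UP TO RELABELLING

Helper file (`--supports stmt-ValiantsHypothesis-22510`; cell valiant-natproofs, rung V4, 𝒟-side door (c); registered line
`Cruxes/AnchoredDoorHitsLowerPairs/Lines/anchored_peeling.lean` v20/v21 (registered residual `Stmt.stub_ltRestNonCanon`, which excludes the canonical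
family only in its LITERAL coordinates); planner mandate val-np-p1 g23 (3) (STATUS 2026-08-28T17:10:58Z: «'symbolicDet_ne_zero_relabel' (simultaneous vertex
relabelling) to narrow NonCanon to "up to isomorphism"»); prover seat val-np-p1 gen 23. Three bookkeeping `def`s (`relabVars`, `anchorRelab`, `paramRelab`).
Closes NO item.

WHAT. Relabel the `x`-variables by a permutation `σ` of `Fin h` and the `y`-variables by a permutation `τ` (`relabVars σ τ`), and the parameters
accordingly (`paramRelab σ τ`: `θ_(A|B) ↦ θ_(σA|τB)`, `φ_{(A|B),b} ↦ φ_{(σA|τB),σb}`, `ψ_{(A|B),d} ↦ ψ_{(σA|τB),τd}`). Then every anchor factor goes to the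
factor of the relabelled anchor (`relab_symbFactor`), the anchor set is invariant, so the symbolic anchored witness 𝔄_s is invariant (`relab_symbolicWitness`);
consequently `symbolicDet s h r (σ ∘ u) (τ ∘ w) = rename (paramRelab σ τ) (symbolicDet s h r u w)` (`symbolicDet_relab`) and NON-VANISHING OF THE SYMBOLIC
MINOR IS INVARIANT UNDER RELABELLING (`symbolicDet_ne_zero_relab_iff`) — the pattern of `…Swap` (x ↔ y) for coordinate permutations.
COROLLARY (`symbolicDet_one_ne_zero_decFamily_relab`): CONJECTURE DC (`stub_decrementFamily`, p654147) holds for every pair that is a RELABELLING of a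
canonical pair `(DecRow k, DecCol k)` — rows and columns may sit on any coordinates, in any order.

WHAT THIS IS NOT: nothing on crux stmt-ValiantsHypothesis-14610 or on `VP` versus `VNP`.
-/

set_option linter.dupNamespace false

namespace Summit.ValiantsHypothesis.ValiantsHypothesis.Theorems.BarrierLever.AnchoredPeeling

open Finset MvPolynomial
open Summit.ValiantsHypothesis.ValiantsHypothesis.Theorems.BarrierLever.BrickCalculus (pexpo pexpo_def)

noncomputable section

variable {h : ℕ}

/-! ## 1. The relabelling maps -/

/-- Simultaneous relabelling of the variables: `x_a ↦ x_{σ a}`, `y_c ↦ y_{τ c}`. -/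
def relabVars (σ τ : Equiv.Perm (Fin h)) : Fin (h + h) ≃ Fin (h + h) :=
  finSumFinEquiv.symm.trans ((Equiv.sumCongr σ τ).trans finSumFinEquiv)

/-- The relabelling on an `x`-variable. -/
theorem relabVars_castAdd (σ τ : Equiv.Perm (Fin h)) (a : Fin h) : relabVars σ τ (Fin.castAdd h a) = Fin.castAdd h (σ a) := by
  simp only [relabVars, Equiv.trans_apply, finSumFinEquiv_symm_apply_castAdd, Equiv.sumCongr_apply, Sum.map_inl,
    finSumFinEquiv_apply_left]

/-- The relabelling on a `y`-variable. -/
theorem relabVars_natAdd (σ τ : Equiv.Perm (Fin h)) (c : Fin h) : relabVars σ τ (Fin.natAdd h c) = Fin.natAdd h (τ c) := by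
  simp only [relabVars, Equiv.trans_apply, finSumFinEquiv_symm_apply_natAdd, Equiv.sumCongr_apply, Sum.map_inr,
    finSumFinEquiv_apply_right]

/-- The relabelling of an anchor `(A | B) ↦ (σ A | τ B)`. -/
def anchorRelab (σ τ : Equiv.Perm (Fin h)) (α : Finset (Fin h) × Finset (Fin h)) : Finset (Fin h) × Finset (Fin h) :=
  (α.1.map σ.toEmbedding, α.2.map τ.toEmbedding)

/-- `anchorRelab` is the product of the induced permutations of `Finset (Fin h)`. -/
theorem anchorRelab_eq (σ τ : Equiv.Perm (Fin h)) (α : Finset (Fin h) × Finset (Fin h)) :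
    anchorRelab σ τ α = (Equiv.prodCongr σ.finsetCongr τ.finsetCongr) α := by
  obtain ⟨A, B⟩ := α
  rfl

/-- The parameter relabelling: `θ_(A|B) ↦ θ_(σA|τB)`, `φ_{(A|B), b} ↦ φ_{(σA|τB), σ b}`, `ψ_{(A|B), d} ↦ ψ_{(σA|τB), τ d}`. -/
def paramRelab (σ τ : Equiv.Perm (Fin h)) : Param h → Param h
  | Sum.inl α => Sum.inl (anchorRelab σ τ α)
  | Sum.inr (Sum.inl (α, b)) => Sum.inr (Sum.inl (anchorRelab σ τ α, σ b))
  | Sum.inr (Sum.inr (α, d)) => Sum.inr (Sum.inr (anchorRelab σ τ α, τ d))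

/-- `anchorRelab` is injective. -/
theorem anchorRelab_injective (σ τ : Equiv.Perm (Fin h)) : Function.Injective (anchorRelab σ τ) := by
  intro α β hαβ
  rw [anchorRelab_eq, anchorRelab_eq] at hαβ
  exact (Equiv.injective _) hαβ

/-- `paramRelab` is injective. -/
theorem paramRelab_injective (σ τ : Equiv.Perm (Fin h)) : Function.Injective (paramRelab σ τ) := by
  intro p q hpq
  rcases p with α | ⟨α, b⟩ | ⟨α, d⟩ <;> rcases q with β | ⟨β, b'⟩ | ⟨β, d'⟩ <;>
    simp only [paramRelab, Sum.inl.injEq, Sum.inr.injEq, Prod.mk.injEq, reduceCtorEq] at hpq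
  · rw [anchorRelab_injective σ τ hpq]
  · rw [anchorRelab_injective σ τ hpq.1, σ.injective hpq.2]
  · rw [anchorRelab_injective σ τ hpq.1, τ.injective hpq.2]

/-- The relabelling maps the partition exponent of `(U, W)` to that of `(σ U, τ W)`. -/
theorem mapDomain_relabVars (σ τ : Equiv.Perm (Fin h)) (U W : Finset (Fin h)) :
    Finsupp.mapDomain (relabVars σ τ) (pexpo U W) = pexpo (U.map σ.toEmbedding) (W.map τ.toEmbedding) := by
  rw [pexpo_def, pexpo_def, Finsupp.mapDomain_add, Finsupp.mapDomain_finsetSum, Finsupp.mapDomain_finsetSum,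
    Finset.sum_map, Finset.sum_map]
  congr 1
  · refine Finset.sum_congr rfl fun a _ => ?_
    rw [Finsupp.mapDomain_single, relabVars_castAdd, Equiv.coe_toEmbedding]
  · refine Finset.sum_congr rfl fun c _ => ?_
    rw [Finsupp.mapDomain_single, relabVars_natAdd, Equiv.coe_toEmbedding]

/-! ## 2. Invariance of the symbolic anchored witness -/

/-- The relabelling on one anchor factor: rename the variables and the parameters — the factor of the relabelled anchor. -/
theorem relab_symbFactor (σ τ : Equiv.Perm (Fin h)) (α : Finset (Fin h) × Finset (Fin h)) :
    MvPolynomial.map (rename (paramRelab σ τ)).toRingHom (rename (relabVars σ τ) (symbFactor h α)) = symbFactor h (anchorRelab σ τ α) := by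
  have hs1 : (univ \ α.1).map σ.toEmbedding = univ \ α.1.map σ.toEmbedding := by
    rw [Finset.map_sdiff, Finset.map_univ_equiv]
  have hs2 : (univ \ α.2).map τ.toEmbedding = univ \ α.2.map τ.toEmbedding := by
    rw [Finset.map_sdiff, Finset.map_univ_equiv]
  rw [symbFactor, symbFactor]
  simp only [anchorRelab]
  rw [← hs1, ← hs2, Finset.prod_map, Finset.prod_map, Finset.prod_map, Finset.prod_map]
  simp only [map_add, map_one, map_mul, map_prod, rename_C, rename_X, map_C, map_X, AlgHom.toRingHom_eq_coe,
    RingHom.coe_coe, relabVars_castAdd, relabVars_natAdd, paramRelab, anchorRelab, Equiv.coe_toEmbedding]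

/-- The anchor set is invariant under relabelling. -/
theorem anchorRelab_mem_anchors_iff (σ τ : Equiv.Perm (Fin h)) (s : ℕ) (α : Finset (Fin h) × Finset (Fin h)) :
    α ∈ anchors s h ↔ anchorRelab σ τ α ∈ anchors s h := by
  simp only [anchors, Finset.mem_filter, Finset.mem_univ, true_and, anchorRelab, Finset.card_map]

/-- **The symbolic anchored witness is invariant under relabelling.** -/
theorem relab_symbolicWitness (σ τ : Equiv.Perm (Fin h)) (s h' : ℕ) (hh : h' = h) :
    MvPolynomial.map (rename (paramRelab σ τ)).toRingHom (rename (relabVars σ τ) (symbolicWitness s h)) = symbolicWitness s h := by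
  subst hh
  rw [symbolicWitness_eq_prod, map_prod, map_prod]
  simp_rw [relab_symbFactor]
  refine Finset.prod_equiv (Equiv.prodCongr σ.finsetCongr τ.finsetCongr) (fun α => ?_) (fun α _ => by rw [anchorRelab_eq])
  rw [← anchorRelab_eq]; exact anchorRelab_mem_anchors_iff σ τ s α

/-- Entries of the relabelled layout are the renamed entries. -/
theorem coeff_symbolicWitness_relab (σ τ : Equiv.Perm (Fin h)) (s : ℕ) (U W : Finset (Fin h)) :
    coeff (pexpo (U.map σ.toEmbedding) (W.map τ.toEmbedding)) (symbolicWitness s h) =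
      rename (paramRelab σ τ) (coeff (pexpo U W) (symbolicWitness s h)) := by
  conv_lhs => rw [← relab_symbolicWitness σ τ s h rfl]
  rw [coeff_map, AlgHom.toRingHom_eq_coe, RingHom.coe_coe, ← mapDomain_relabVars σ τ U W,
    coeff_rename_mapDomain _ (relabVars σ τ).injective]

/-! ## 3. The symbolic minor under relabelling -/

/-- **Relabelling formula:** the symbolic minor of the relabelled layout `(σ ∘ u, τ ∘ w)` is the renamed symbolic minor of `(u, w)`. -/
theorem symbolicDet_relab (σ τ : Equiv.Perm (Fin h)) (s r : ℕ) (u w : Fin r → Finset (Fin h)) :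
    symbolicDet s h r (fun i => (u i).map σ.toEmbedding) (fun j => (w j).map τ.toEmbedding) = rename (paramRelab σ τ) (symbolicDet s h r u w) := by
  have h1 : symbolicDet s h r u w = (Matrix.of fun i j : Fin r => coeff (pexpo (u i) (w j)) (symbolicWitness s h)).det := rfl
  have h2 : symbolicDet s h r (fun i => (u i).map σ.toEmbedding) (fun j => (w j).map τ.toEmbedding) =
      (Matrix.of fun i j : Fin r => coeff (pexpo ((u i).map σ.toEmbedding) ((w j).map τ.toEmbedding)) (symbolicWitness s h)).det := rfl
  rw [h1, h2, AlgHom.map_det]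
  congr 1
  ext i j
  rw [AlgHom.mapMatrix_apply, Matrix.map_apply, Matrix.of_apply, Matrix.of_apply, coeff_symbolicWitness_relab]

/-- **Non-vanishing of the symbolic minor is invariant under relabelling.** -/
theorem symbolicDet_ne_zero_relab_iff (σ τ : Equiv.Perm (Fin h)) (s r : ℕ) (u w : Fin r → Finset (Fin h)) :
    symbolicDet s h r (fun i => (u i).map σ.toEmbedding) (fun j => (w j).map τ.toEmbedding) ≠ 0 ↔ symbolicDet s h r u w ≠ 0 := by
  rw [symbolicDet_relab]
  constructor
  · intro hne h0; exact hne (by rw [h0, map_zero])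
  · intro hne h0; exact hne (rename_injective _ (paramRelab_injective σ τ) (by rw [h0, map_zero]))

/-! ## 4. Conjecture DC up to relabelling -/

/-- **CONJECTURE DC UP TO RELABELLING.** For `k ≥ 1` and `h` large, every injective column enumeration `w` and every row enumeration `u` whose ranges are,
after relabelling the coordinates by permutations `σ` (rows) and `τ` (columns) of `Fin h`, exactly the canonical rows `DecRow k h` and columns `DecCol k h`,
have nonzero profile-1 symbolic minor. (`stub_decrementFamily` is the case `σ = τ = 1`.) -/
theorem symbolicDet_one_ne_zero_decFamily_relab (k h r : ℕ) (u w : Fin r → Finset (Fin h)) (σ τ : Equiv.Perm (Fin h)) (hk : 1 ≤ k)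
    (hkh : 2 * k + 1 ≤ h) (hKh : 2 ^ (k + 1) - 1 ≤ h) (hw : Function.Injective w)
    (hU : ∀ U : Finset (Fin h), U ∈ Set.range u ↔ DecRow k h (U.map σ.toEmbedding))
    (hW : ∀ W : Finset (Fin h), W ∈ Set.range w ↔ DecCol k h (W.map τ.toEmbedding)) :
    symbolicDet 1 h r u w ≠ 0 := by
  rw [← symbolicDet_ne_zero_relab_iff σ τ]
  refine DecFamily.symbolicDet_one_ne_zero_decFamily k h r _ _ hk hkh hKh (fun j j' hjj => hw (Finset.map_injective _ hjj)) (fun U => ?_) (fun W => ?_)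
  · constructor
    · rintro ⟨i, rfl⟩; exact (hU (u i)).mp ⟨i, rfl⟩
    · intro hD
      have hpre : (U.map σ.symm.toEmbedding).map σ.toEmbedding = U := by
        rw [Finset.map_map]; convert Finset.map_refl (s := U) using 2; ext x; simp
      obtain ⟨i, hi⟩ := (hU (U.map σ.symm.toEmbedding)).mpr (by rw [hpre]; exact hD)
      exact ⟨i, by simp only []; rw [hi, hpre]⟩
  · constructor
    · rintro ⟨j, rfl⟩; exact (hW (w j)).mp ⟨j, rfl⟩
    · intro hD
      have hpre : (W.map τ.symm.toEmbedding).map τ.toEmbedding = W := by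
        rw [Finset.map_map]; convert Finset.map_refl (s := W) using 2; ext x; simp
      obtain ⟨j, hj⟩ := (hW (W.map τ.symm.toEmbedding)).mpr (by rw [hpre]; exact hD)
      exact ⟨j, by simp only []; rw [hj, hpre]⟩

end

end Summit.ValiantsHypothesis.ValiantsHypothesis.Theorems.BarrierLever.AnchoredPeeling
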